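import Mathlib.LinearAlgebra.Quotient.Basic
import Mathlib.LinearAlgebra.Span.Basic
import HarnessLib

/-!
# Commuting families with a stable filtration of scalar type

Topic `LinearAlgebra`; namespace `Literature.LinearAlgebra`.  Mathlib only; one inductive
predicate and theorems.

Let `T : X → End_k(V)` be a family of endomorphisms (indexed by any type `X`) and `S` a set of
"characters" `X → k`.  The predicate `ScalarFiltered T S W` on submodules `W ≤ V` is generated by
`⊥` and by passing from `W` to a larger `W'` on which every `T x` acts, modulo `W`, by the scalar
`ω x` for one `ω ∈ S` (`ScalarFiltered.step`).  Consequences: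

* a common eigenvector `v ≠ 0` in a `ScalarFiltered` module, `T x v = χ x • v`, has `χ = ω` on `X`
  for some `ω ∈ S` (`exists_eq_of_eigenvector`);
* the predicate passes to `T`-stable submodules (`comap_subtype`), quotients (`map_mkQ`),
  extensions (`of_extension`), along injective and surjective equivariant maps (`of_injective`,
  `of_surjective`), and across the middle term of an exact sequence (`of_exact`).

This is the bookkeeping behind "the eigencharacters of Hecke-type operators on a filtered
cohomology group are among the graded characters" (used for the torus eigenvalues on the
cohomology of the Borel stratum, Harder 1987 §2). [folklore]

## References

* N. Bourbaki, *Algèbre*, Ch. VII §5 (triangularisation of commuting families). [folklore]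
-/

namespace Literature.LinearAlgebra

variable {k : Type*} [Field k] {V : Type*} [AddCommGroup V] [Module k V] {X : Type*}

/-- **Scalar-type filtrations.**  `ScalarFiltered T S W`: the submodule `W` has a finite
filtration `⊥ = W₀ ≤ W₁ ≤ ⋯ ≤ W_m = W` such that on each `W_{i+1}/W_i` every `T x` acts by the
scalar `ω_i x`, `ω_i ∈ S`. [folklore] -/
inductive ScalarFiltered (T : X → Module.End k V) (S : Set (X → k)) : Submodule k V → Prop
  | bot : ScalarFiltered T S ⊥
  | step {W W' : Submodule k V} (hW : ScalarFiltered T S W) (hle : W ≤ W') (ω : X → k) (hω : ω ∈ S)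
      (hact : ∀ x, ∀ v ∈ W', T x v - ω x • v ∈ W) : ScalarFiltered T S W'

namespace ScalarFiltered

variable {T : X → Module.End k V} {S : Set (X → k)}

/-- A `ScalarFiltered` submodule is `T`-stable. [folklore] -/
theorem stable {W : Submodule k V} (h : ScalarFiltered T S W) (x : X) {v : V} (hv : v ∈ W) :
    T x v ∈ W := by
  induction h with
  | bot =>
    rw [Submodule.mem_bot] at hv
    rw [hv, map_zero]
    exact Submodule.zero_mem _
  | step hW hle ω hω hact ih =>
    have h1 := hact x _ hv
    have h2 : T x v = (T x v - ω x • v) + ω x • v := (sub_add_cancel _ _).symm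
    rw [h2]
    exact Submodule.add_mem _ (hle h1) (Submodule.smul_mem _ _ hv)

/-- **The eigencharacter of a common eigenvector lies in `S`.** [folklore] -/
theorem exists_eq_of_eigenvector {W : Submodule k V} (h : ScalarFiltered T S W) {v : V} (hv : v ∈ W)
    (hv0 : v ≠ 0) (χ : X → k) (heig : ∀ x, T x v = χ x • v) : ∃ ω ∈ S, ∀ x, χ x = ω x := by
  induction h with
  | bot =>
    rw [Submodule.mem_bot] at hv
    exact absurd hv hv0
  | step hW hle ω hω hact ih =>
    rename_i W W'
    by_cases hvW : v ∈ W
    · exact ih hvW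
    · refine ⟨ω, hω, fun x => ?_⟩
      by_contra hne
      have h1 : T x v - ω x • v ∈ W := hact x v hv
      rw [heig x, ← sub_smul] at h1
      have h2 : (χ x - ω x)⁻¹ • ((χ x - ω x) • v) ∈ W := Submodule.smul_mem _ _ h1
      rw [smul_smul, inv_mul_cancel₀ (sub_ne_zero.2 hne), one_smul] at h2
      exact hvW h2

/-- Monotonicity in `S`. [folklore] -/
theorem mono {S' : Set (X → k)} (hS : S ⊆ S') {W : Submodule k V} (h : ScalarFiltered T S W) :
    ScalarFiltered T S' W := by
  induction h with
  | bot => exact bot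
  | step hW hle ω hω hact ih => exact step ih hle ω (hS hω) hact

/-- A module on which every `T x` is the scalar `ω x` is scalar-filtered. [folklore] -/
theorem of_scalar (ω : X → k) (hω : ω ∈ S) (W : Submodule k V) (h : ∀ x, ∀ v ∈ W, T x v = ω x • v) :
    ScalarFiltered T S W :=
  step bot bot_le ω hω fun x v hv => by rw [h x v hv, sub_self]; exact Submodule.zero_mem _

/-! ### Transport along equivariant linear maps -/

variable {V' : Type*} [AddCommGroup V'] [Module k V'] {T' : X → Module.End k V'}

/-- **Pull-back along an injective equivariant map.** [folklore] -/
theorem comap_of_injective (f : V →ₗ[k] V') (hf : Function.Injective f) (hT : ∀ x v, f (T x v) = T' x (f v))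
    {W' : Submodule k V'} (h : ScalarFiltered T' S W') : ScalarFiltered T S (W'.comap f) := by
  induction h with
  | bot =>
    rw [Submodule.comap_bot, LinearMap.ker_eq_bot.2 hf]
    exact bot
  | step hW hle ω hω hact ih =>
    refine step ih (Submodule.comap_mono hle) ω hω fun x v hv => ?_
    rw [Submodule.mem_comap] at hv ⊢
    rw [map_sub, map_smul, hT]
    exact hact x _ hv

/-- **Push-forward along a surjective-onto-its-image equivariant map**: the image of a scalar-filtered
submodule is scalar-filtered. [folklore] -/
theorem map_of_equivariant (f : V →ₗ[k] V') (hT : ∀ x v, f (T x v) = T' x (f v))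
    {W : Submodule k V} (h : ScalarFiltered T S W) : ScalarFiltered T' S (W.map f) := by
  induction h with
  | bot =>
    rw [Submodule.map_bot]
    exact bot
  | step hW hle ω hω hact ih =>
    refine step ih (Submodule.map_mono hle) ω hω fun x v hv => ?_
    rw [Submodule.mem_map] at hv ⊢
    obtain ⟨w, hw, rfl⟩ := hv
    exact ⟨T x w - ω x • w, hact x w hw, by rw [map_sub, map_smul, hT]⟩

/-! ### Submodules, quotients, extensions -/

/-- **Restriction to a `T`-stable submodule.** [folklore] -/
theorem comap_subtype (U : Submodule k V) (hU : ∀ x, ∀ u ∈ U, T x u ∈ U) {W : Submodule k V}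
    (h : ScalarFiltered T S W) :
    ScalarFiltered (fun x => (T x).restrict (hU x)) S (W.comap U.subtype) :=
  comap_of_injective U.subtype Subtype.val_injective (fun _ _ => rfl) h

/-- **Passage to the quotient by a `T`-stable submodule.** [folklore] -/
theorem map_mkQ (U : Submodule k V) (hU : ∀ x, ∀ u ∈ U, T x u ∈ U) {W : Submodule k V}
    (h : ScalarFiltered T S W) :
    ScalarFiltered (fun x => U.mapQ U (T x) fun u hu => hU x u hu) S (W.map U.mkQ) :=
  map_of_equivariant U.mkQ (fun _ _ => rfl) h

/-- **Extensions**: if `U` is scalar-filtered and `V/U` is scalar-filtered then `V` is. [folklore] -/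
theorem of_extension (U : Submodule k V) (hU : ∀ x, ∀ u ∈ U, T x u ∈ U) (hUgood : ScalarFiltered T S U)
    {Z : Submodule k (V ⧸ U)}
    (hZ : ScalarFiltered (fun x => U.mapQ U (T x) fun u hu => hU x u hu) S Z) :
    ScalarFiltered T S (Z.comap U.mkQ) := by
  induction hZ with
  | bot =>
    rw [Submodule.comap_bot, Submodule.ker_mkQ]
    exact hUgood
  | step hW hle ω hω hact ih =>
    refine step ih (Submodule.comap_mono hle) ω hω fun x v hv => ?_
    rw [Submodule.mem_comap] at hv ⊢
    have := hact x _ hv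
    rwa [← map_smul, show (U.mapQ U (T x) fun u hu => hU x u hu) (U.mkQ v) = U.mkQ (T x v) from rfl,
      ← map_sub] at this

/-- Extensions, `⊤` form. [folklore] -/
theorem top_of_extension (U : Submodule k V) (hU : ∀ x, ∀ u ∈ U, T x u ∈ U) (hUgood : ScalarFiltered T S U)
    (hQ : ScalarFiltered (fun x => U.mapQ U (T x) fun u hu => hU x u hu) S ⊤) :
    ScalarFiltered T S ⊤ := by
  have := of_extension U hU hUgood hQ
  rwa [Submodule.comap_top] at this

/-! ### Exact sequences -/

variable {V'' : Type*} [AddCommGroup V''] [Module k V''] {T'' : X → Module.End k V''}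

/-- **Middle terms of exact sequences**: for equivariant `f : V' → V`, `g : V → V''` with
`range f = ker g`, if `V'` and `V''` are scalar-filtered then so is `V`. [folklore] -/
theorem of_exact (f : V' →ₗ[k] V) (g : V →ₗ[k] V'') (hf : ∀ x v, f (T' x v) = T x (f v))
    (hg : ∀ x v, g (T x v) = T'' x (g v)) (hexact : LinearMap.range f = LinearMap.ker g)
    (h' : ScalarFiltered T' S ⊤) (h'' : ScalarFiltered T'' S ⊤) : ScalarFiltered T S ⊤ := by
  -- `U = range f = ker g` is stable and scalar-filtered (image of `V'`)
  set U : Submodule k V := LinearMap.range f with hUdef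
  have hU : ∀ x, ∀ u ∈ U, T x u ∈ U := by
    rintro x u ⟨w, rfl⟩
    exact ⟨T' x w, hf x w⟩
  have hUgood : ScalarFiltered T S U := by
    have := map_of_equivariant (T := T') (T' := T) (S := S) f hf h'
    rwa [Submodule.map_top] at this
  refine top_of_extension U hU hUgood ?_
  -- `V/U ↪ V''` is injective and equivariant
  have hker : U ≤ LinearMap.ker g := hexact.le
  set gbar : (V ⧸ U) →ₗ[k] V'' := U.liftQ g hker with hgbar
  have hinj : Function.Injective gbar := by
    rw [← LinearMap.ker_eq_bot, hgbar, Submodule.ker_liftQ, ← hexact, Submodule.mkQ_map_self]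
  have hequiv : ∀ x (v : V ⧸ U), gbar ((U.mapQ U (T x) fun u hu => hU x u hu) v) = T'' x (gbar v) := by
    intro x v
    induction v using Submodule.Quotient.induction_on with
    | H v =>
      rw [Submodule.mapQ_apply, hgbar, Submodule.liftQ_apply, Submodule.liftQ_apply, hg]
  have := comap_of_injective (T := fun x => U.mapQ U (T x) fun u hu => hU x u hu) (T' := T'') (S := S)
    gbar hinj hequiv h''
  rwa [Submodule.comap_top] at this

/-- **Along an injective equivariant map**, `⊤` form. [folklore] -/
theorem of_injective (f : V →ₗ[k] V') (hf : Function.Injective f) (hT : ∀ x v, f (T x v) = T' x (f v))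
    (h : ScalarFiltered T' S ⊤) : ScalarFiltered T S ⊤ := by
  have := comap_of_injective (S := S) f hf hT h
  rwa [Submodule.comap_top] at this

/-- **Along a surjective equivariant map**, `⊤` form. [folklore] -/
theorem of_surjective (f : V →ₗ[k] V') (hf : Function.Surjective f) (hT : ∀ x v, f (T x v) = T' x (f v))
    (h : ScalarFiltered T S ⊤) : ScalarFiltered T' S ⊤ := by
  have := map_of_equivariant (S := S) f hT h
  rwa [Submodule.map_top, LinearMap.range_eq_top.2 hf] at this

/-- **The eigencharacter of a common eigenvector of a scalar-filtered module lies in `S`**, `⊤` form.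
[folklore] -/
theorem exists_eq_of_eigenvector_top (h : ScalarFiltered T S ⊤) {v : V} (hv0 : v ≠ 0) (χ : X → k)
    (heig : ∀ x, T x v = χ x • v) : ∃ ω ∈ S, ∀ x, χ x = ω x :=
  exists_eq_of_eigenvector h Submodule.mem_top hv0 χ heig

end ScalarFiltered

end Literature.LinearAlgebra
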